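import Summits.Ventures.PercRepro.C026HubAttachA

/-!
# Hub attachment and the D-free inequality, II: the H-graph through the hubs (p5, gen 10)

The H-graph of a single-direction configuration `ω` is the H-graph of its base `β = baseOf Hs ω` with
three kinds of VIRTUAL edges added, one per signature bit (`C026HubAttachA.lean`): `c – a` when
`SigM a` (a hub joins `c` to `K` through closed edges), `c – b` when `SigM b`, and `a – b` when
`SigLink` (a hub inside `M` with all its `c`-edges open links `K` and `L` without touching `c`).

* **`AugAdj Hs X ω a b c`** — the augmented relation: base H-steps between non-hubs avoiding `X`, and
  the virtual edges whose witnessing hub lies outside `X`;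
* the realisations **`hConnAvoid_of_sigM`** / **`hConnAvoid_of_sigLink`** (a virtual edge is an H-walk
  of length two through its hub) and **`hAdj_of_base`** / **`hAdj_base_of`** (H-steps between non-hubs
  are the same in `ω` and in the base);
* the anchor lemmas `anchor_of_notMem_M` / `anchor_of_mem_M` (which marks are H-neighbours of a hub);
  the projection itself is `C026HubAttachC.lean`.
-/

namespace PercRepro

namespace MultiGraph

variable {V E : Type*} {G : MultiGraph V E}

section Aug

variable (G)

/-- **The augmented relation**: a base H-step between non-hubs outside `X`, or a virtual edge
`c – a` (`SigM a`), `c – b` (`SigM b`), `a – b` (`SigLink`) with both endpoints outside `X`. -/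
def AugAdj (Hs X : Set V) (ω : Config E) (a b c : V) (u v : V) : Prop :=
  (u ∉ Hs ∧ v ∉ Hs ∧ u ∉ X ∧ v ∉ X ∧ G.HAdj (G.baseOf Hs ω) c u v) ∨
    (u ∉ X ∧ v ∉ X ∧
      ((G.SigM Hs X ω a c ∧ ((u = c ∧ v = a) ∨ (u = a ∧ v = c))) ∨
        (G.SigM Hs X ω b c ∧ ((u = c ∧ v = b) ∨ (u = b ∧ v = c))) ∨
          (G.SigLink Hs X ω a b c ∧ ((u = a ∧ v = b) ∨ (u = b ∧ v = a)))))

variable {G}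

/-- `Link` and `Joins` are the same relation. -/
theorem Link.joins {e : E} {x y : V} (hl : G.Link e x y) : G.Joins e x y := hl

/-- `Joins` as a `Link`. -/
theorem Joins.link {e : E} {x y : V} (hl : G.Joins e x y) : G.Link e x y := hl

/-- The augmented relation is symmetric. -/
theorem AugAdj.symm {Hs X : Set V} {ω : Config E} {a b c u v : V}
    (h : G.AugAdj Hs X ω a b c u v) : G.AugAdj Hs X ω a b c v u := by
  rcases h with ⟨hu, hv, huX, hvX, hadj⟩ | ⟨huX, hvX, hvirt⟩
  · exact Or.inl ⟨hv, hu, hvX, huX, G.hAdj_symm hadj⟩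
  · refine Or.inr ⟨hvX, huX, ?_⟩
    have sw : ∀ {p q r s : Prop}, (p ∧ q) ∨ (r ∧ s) → (s ∧ r) ∨ (q ∧ p) := fun h =>
      h.elim (fun ⟨h1, h2⟩ => Or.inr ⟨h2, h1⟩) (fun ⟨h1, h2⟩ => Or.inl ⟨h2, h1⟩)
    rcases hvirt with ⟨hs, h⟩ | ⟨hs, h⟩ | ⟨hs, h⟩
    · exact Or.inl ⟨hs, sw h⟩
    · exact Or.inr (Or.inl ⟨hs, sw h⟩)
    · exact Or.inr (Or.inr ⟨hs, sw h⟩)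

end Aug

section Walk

variable {Hs : Set V} {a b c : V} {ω : Config E}

/-- `a ∉ M`. -/
theorem IsBot.a_notMem_M (hbot : G.IsBot ω a b c) : a ∉ G.cluster ω c :=
  fun h => hbot.2.1 (h : G.Conn ω c a).symm

/-- `b ∉ M`. -/
theorem IsBot.b_notMem_M (hbot : G.IsBot ω a b c) : b ∉ G.cluster ω c :=
  fun h => hbot.2.2 (h : G.Conn ω c b).symm

/-- `c ∈ M`. -/
theorem c_mem_M (ω : Config E) (c : V) : c ∈ G.cluster ω c := G.self_mem_cluster ω c

/-- A mark in `M` is `c`. -/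
theorem IsBot.eq_c_of_mem_M (hbot : G.IsBot ω a b c) {m : V} (hm : m = a ∨ m = b ∨ m = c)
    (hmM : m ∈ G.cluster ω c) : m = c := by
  rcases hm with rfl | rfl | rfl
  · exact (hbot.a_notMem_M hmM).elim
  · exact (hbot.b_notMem_M hmM).elim
  · rfl

/-- An edge at a hub is closed when the hub is not open to its other endpoint. -/
theorem closedTo_of_link_of_not_openTo {h y : V} {e : E} (hl : G.Link e h y)
    (hno : ¬ G.OpenTo ω h y) : G.ClosedTo ω h y := by
  refine ⟨e, ?_, hl⟩
  cases he : ω e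
  · rfl
  · exact (hno ⟨e, he, hl⟩).elim

variable (hH : G.IsHubSet Hs a b c) (hbot : G.IsBot ω a b c)
include hH hbot

/-- A non-hub lies in `M` iff it lies in the base `M₀`. -/
theorem IsHubSet.mem_M_iff_base {z : V} (hz : z ∉ Hs) :
    z ∈ G.cluster ω c ↔ z ∈ G.cluster (G.baseOf Hs ω) c :=
  hH.nonhub_conn_mark_iff hbot hz (Or.inr (Or.inr rfl))

/-- A hub lies in `M` iff it is open to `c`. -/
theorem IsHubSet.hub_mem_M_iff {h : V} (hh : h ∈ Hs) :
    h ∈ G.cluster ω c ↔ G.OpenTo ω h c :=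
  hH.hub_conn_mark_iff hbot hh (Or.inr (Or.inr rfl))

/-- A hub outside `M` connected to a vertex `z ≠ h` is open to a mark `m ≠ c` connected to `z`. -/
theorem IsHubSet.conn_of_hub_notMem_M {h : V} (hh : h ∈ Hs) (hhM : h ∉ G.cluster ω c) {z : V}
    (hz : z ≠ h) (hconn : G.Conn ω h z) :
    ∃ m, (m = a ∨ m = b) ∧ G.OpenTo ω h m ∧ G.Conn ω m z := by
  rcases (hH h hh).1.conn_iff.1 hconn with h' | ⟨m, hm, hopen, hmz⟩
  · exact (hz h').elim
  · rcases hm with rfl | rfl | rfl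
    · exact ⟨m, Or.inl rfl, hopen, hmz⟩
    · exact ⟨m, Or.inr rfl, hopen, hmz⟩
    · exact (hhM ((hH.hub_mem_M_iff hbot hh).2 hopen)).elim

/-- **H-neighbours of a hub outside `M`** (state `m`: open to the mark `m ≠ c`): a mark `t` is an
H-neighbour of `h` only if `t = m`, or `t = c` and `h` has a closed `c`-edge (then `SigM m` holds
as soon as `h ∉ X`). -/
theorem IsHubSet.anchor_of_notMem_M {h : V} (hh : h ∈ Hs) (hhM : h ∉ G.cluster ω c) {m : V}
    (hm : m = a ∨ m = b) (hopen : G.OpenTo ω h m) {t : V} (ht : t = a ∨ t = b ∨ t = c)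
    (hadj : G.HAdj ω c h t) : t = m ∨ (t = c ∧ G.ClosedTo ω h c) := by
  have hcM : c ∈ G.cluster ω c := c_mem_M ω c
  by_cases htc : t = c
  · subst htc
    right
    refine ⟨rfl, ?_⟩
    rcases hadj with ⟨hhM', -⟩ | ⟨-, e, hj⟩ | ⟨-, htM, -⟩
    · exact (hhM hhM').elim
    · exact closedTo_of_link_of_not_openTo hj.link fun ho => hhM ((hH.hub_mem_M_iff hbot hh).2 ho)
    · exact (htM hcM).elim
  · left
    have htM : t ∉ G.cluster ω c := fun htM => htc (hbot.eq_c_of_mem_M ht htM)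
    rcases hadj with ⟨hhM', -⟩ | ⟨hiff, -⟩ | ⟨-, -, hconn⟩
    · exact (hhM hhM').elim
    · exact absurd (hiff.2 htM) hhM
    · -- `h` is connected to `t` and to `m`: single direction forces `t = m`
      have hopen' : G.OpenTo ω h t := (hH.hub_conn_mark_iff hbot hh ht).1 hconn.symm
      obtain ⟨h1, h2, h3⟩ := hbot.singleDir (Hs := Hs) h hh
      rcases hm with rfl | rfl <;> rcases ht with rfl | rfl | rfl
      · rfl
      · exact (h1 ⟨hopen, hopen'⟩).elim
      · exact (htc rfl).elim
      · exact (h1 ⟨hopen', hopen⟩).elim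
      · rfl
      · exact (htc rfl).elim


/-- **H-neighbours of a hub outside `M`, without knowing its state**: a mark `t` is an H-neighbour
only if `t = c`, or `t ∈ {a, b}` and the hub is open to `t`. -/
theorem IsHubSet.anchor_of_notMem_M' {h : V} (hh : h ∈ Hs) (hhM : h ∉ G.cluster ω c) {t : V}
    (ht : t = a ∨ t = b ∨ t = c) (hadj : G.HAdj ω c h t) :
    t = c ∨ ((t = a ∨ t = b) ∧ G.OpenTo ω h t) := by
  by_cases htc : t = c
  · exact Or.inl htc
  · right
    have htM : t ∉ G.cluster ω c := fun htM => htc (hbot.eq_c_of_mem_M ht htM)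
    refine ⟨?_, ?_⟩
    · rcases ht with h | h | h
      · exact Or.inl h
      · exact Or.inr h
      · exact (htc h).elim
    · rcases hadj with ⟨hhM', -⟩ | ⟨hiff, -⟩ | ⟨-, -, hconn⟩
      · exact (hhM hhM').elim
      · exact absurd (hiff.2 htM) hhM
      · exact (hH.hub_conn_mark_iff hbot hh ht).1 hconn.symm

omit hH in
/-- **H-neighbours of a vertex inside `M`**: a mark `t` is an H-neighbour of `h ∈ M` only if `t = c`
and `h` has a closed `c`-edge, or `t ≠ c` and `h` has an edge to `t`. -/
theorem IsBot.anchor_of_mem_M {h : V} (hhM : h ∈ G.cluster ω c) {t : V}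
    (ht : t = a ∨ t = b ∨ t = c) (hadj : G.HAdj ω c h t) :
    (t = c ∧ G.ClosedTo ω h c) ∨ (t ≠ c ∧ G.HasEdge h t) := by
  by_cases htc : t = c
  · subst htc
    left
    refine ⟨rfl, ?_⟩
    rcases hadj with ⟨-, -, e, he, hj⟩ | ⟨hiff, -⟩ | ⟨hhM', -⟩
    · exact ⟨e, he, hj.link⟩
    · exact absurd (c_mem_M ω t) (hiff.1 hhM)
    · exact (hhM' hhM).elim
  · right
    refine ⟨htc, ?_⟩
    have htM : t ∉ G.cluster ω c := fun htM => htc (hbot.eq_c_of_mem_M ht htM)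
    rcases hadj with ⟨-, htM', -⟩ | ⟨-, e, hj⟩ | ⟨hhM', -⟩
    · exact (htM htM').elim
    · exact ⟨e, hj.link⟩
    · exact (hhM' hhM).elim

omit hbot in
/-- An H-step from a hub to a non-mark is a free step inside a cluster outside `M`. -/
theorem IsHubSet.hAdj_hub_nonmark {h : V} (hh : h ∈ Hs) {z : V} (hz : ¬ (z = a ∨ z = b ∨ z = c))
    (hadj : G.HAdj ω c h z) : h ∉ G.cluster ω c ∧ z ∉ G.cluster ω c ∧ G.Conn ω h z := by
  rcases hadj with ⟨-, -, e, -, hj⟩ | ⟨-, e, hj⟩ | h3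
  · exact (hz (hH.mark_of_link hh hj.link)).elim
  · exact (hz (hH.mark_of_link hh hj.link)).elim
  · exact h3

/-! ### The realisations of the virtual edges -/

/-- **A virtual edge `c – m` is an H-walk of length two through its hub.** -/
theorem IsHubSet.hConnAvoid_of_sigM {X : Set V} (hXc : c ∉ X) {m : V} (hm : m = a ∨ m = b)
    (hmX : m ∉ X) (hs : G.SigM Hs X ω m c) : G.HConnAvoid ω c X c m := by
  obtain ⟨h, hh, hhX, hcase⟩ := hs
  have hmM : m ∉ G.cluster ω c := by
    rcases hm with rfl | rfl
    · exact hbot.a_notMem_M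
    · exact hbot.b_notMem_M
  have hcM : c ∈ G.cluster ω c := c_mem_M ω c
  rcases hcase with ⟨hopen, e₂, he₂, hl₂⟩ | ⟨hopenc, ⟨e₂, he₂, hl₂⟩, e₃, hl₃⟩
  · -- state `m`: `h ∉ M`, the closed `c`-edge is an H-edge `c – h`, then free movement to `m`
    have hhM : h ∉ G.cluster ω c := by
      intro hhM
      have hopenc : G.OpenTo ω h c := (hH.hub_mem_M_iff hbot hh).1 hhM
      obtain ⟨-, h2, h3⟩ := hbot.singleDir (Hs := Hs) h hh
      rcases hm with rfl | rfl
      · exact h2 ⟨hopen, hopenc⟩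
      · exact h3 ⟨hopen, hopenc⟩
    have step1 : G.HAdj ω c c h :=
      Or.inr (Or.inl ⟨⟨fun _ => hhM, fun _ => hcM⟩, e₂, hl₂.symm.joins⟩)
    have step2 : G.HAdj ω c h m := Or.inr (Or.inr ⟨hhM, hmM, hopen.conn⟩)
    exact Relation.ReflTransGen.tail (Relation.ReflTransGen.single ⟨step1, hXc, hhX⟩)
      ⟨step2, hhX, hmX⟩
  · -- mixed `c`-star: `h ∈ M`, `c – h` is an internal H-edge, `h – m` an attachment
    have hhM : h ∈ G.cluster ω c := (hH.hub_mem_M_iff hbot hh).2 hopenc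
    have step1 : G.HAdj ω c c h := Or.inl ⟨hcM, hhM, e₂, he₂, hl₂.symm.joins⟩
    have step2 : G.HAdj ω c h m :=
      Or.inr (Or.inl ⟨⟨fun _ => hmM, fun _ => hhM⟩, e₃, hl₃.joins⟩)
    exact Relation.ReflTransGen.tail (Relation.ReflTransGen.single ⟨step1, hXc, hhX⟩)
      ⟨step2, hhX, hmX⟩

/-- **A virtual link `a – b` is an H-walk of length two through its hub.** -/
theorem IsHubSet.hConnAvoid_of_sigLink {X : Set V} (haX : a ∉ X) (hbX : b ∉ X)
    (hs : G.SigLink Hs X ω a b c) : G.HConnAvoid ω c X a b := by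
  obtain ⟨h, hh, hhX, hopenc, -, ⟨e₁, hl₁⟩, e₂, hl₂⟩ := hs
  have hhM : h ∈ G.cluster ω c := (hH.hub_mem_M_iff hbot hh).2 hopenc
  clear hh
  have step1 : G.HAdj ω c a h :=
    Or.inr (Or.inl ⟨⟨fun h' => (hbot.a_notMem_M h').elim, fun h' => (h' hhM).elim⟩, e₁,
      hl₁.symm.joins⟩)
  have step2 : G.HAdj ω c h b :=
    Or.inr (Or.inl ⟨⟨fun _ => hbot.b_notMem_M, fun _ => hhM⟩, e₂, hl₂.joins⟩)
  exact Relation.ReflTransGen.tail (Relation.ReflTransGen.single ⟨step1, haX, hhX⟩)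
    ⟨step2, hhX, hbX⟩

/-- **H-steps between non-hubs are the same in `ω` and in the base.** -/
theorem IsHubSet.hAdj_nonhub_iff {u v : V} (hu : u ∉ Hs) (hv : v ∉ Hs) :
    G.HAdj ω c u v ↔ G.HAdj (G.baseOf Hs ω) c u v := by
  have hsd := hbot.singleDir (Hs := Hs)
  have hMu := hH.mem_M_iff_base hbot hu
  have hMv := hH.mem_M_iff_base hbot hv
  have hconn := hH.conn_iff_base' hsd hu hv
  have hedge : ∀ e, G.Joins e u v → G.baseOf Hs ω e = ω e := fun e hj =>
    baseOf_apply_of_notMem ω (notMem_edgesAt_of_link hj.link hu hv)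
  constructor
  · rintro (⟨huM, hvM, e, he, hj⟩ | ⟨hiff, e, hj⟩ | ⟨huM, hvM, hc⟩)
    · exact Or.inl ⟨hMu.1 huM, hMv.1 hvM, e, by rw [hedge e hj]; exact he, hj⟩
    · exact Or.inr (Or.inl ⟨by rw [← hMu, ← hMv]; exact hiff, e, hj⟩)
    · exact Or.inr (Or.inr ⟨fun h => huM (hMu.2 h), fun h => hvM (hMv.2 h), hconn.1 hc⟩)
  · rintro (⟨huM, hvM, e, he, hj⟩ | ⟨hiff, e, hj⟩ | ⟨huM, hvM, hc⟩)
    · exact Or.inl ⟨hMu.2 huM, hMv.2 hvM, e, by rw [← hedge e hj]; exact he, hj⟩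
    · exact Or.inr (Or.inl ⟨by rw [hMu, hMv]; exact hiff, e, hj⟩)
    · exact Or.inr (Or.inr ⟨fun h => huM (hMu.1 h), fun h => hvM (hMv.1 h), hconn.2 hc⟩)

/-- A base H-step between non-hubs is an H-step of `ω`. -/
theorem IsHubSet.hAdj_of_base {u v : V} (hu : u ∉ Hs) (hv : v ∉ Hs)
    (h : G.HAdj (G.baseOf Hs ω) c u v) : G.HAdj ω c u v :=
  (hH.hAdj_nonhub_iff hbot hu hv).2 h

/-- **Augmented steps are H-walks avoiding `X`.** -/
theorem IsHubSet.hConnAvoid_of_augAdj {X : Set V} (hXc : c ∉ X) {u v : V}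
    (h : G.AugAdj Hs X ω a b c u v) : G.HConnAvoid ω c X u v := by
  rcases h with ⟨hu, hv, huX, hvX, hadj⟩ | ⟨huX, hvX, hvirt⟩
  · exact Relation.ReflTransGen.single ⟨hH.hAdj_of_base hbot hu hv hadj, huX, hvX⟩
  · rcases hvirt with ⟨hs, ⟨rfl, rfl⟩ | ⟨rfl, rfl⟩⟩ | ⟨hs, ⟨rfl, rfl⟩ | ⟨rfl, rfl⟩⟩ |
      ⟨hs, ⟨rfl, rfl⟩ | ⟨rfl, rfl⟩⟩
    · exact hH.hConnAvoid_of_sigM hbot hXc (Or.inl rfl) hvX hs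
    · exact G.hConnAvoid_symm (hH.hConnAvoid_of_sigM hbot hXc (Or.inl rfl) huX hs)
    · exact hH.hConnAvoid_of_sigM hbot hXc (Or.inr rfl) hvX hs
    · exact G.hConnAvoid_symm (hH.hConnAvoid_of_sigM hbot hXc (Or.inr rfl) huX hs)
    · exact hH.hConnAvoid_of_sigLink hbot huX hvX hs
    · exact G.hConnAvoid_symm (hH.hConnAvoid_of_sigLink hbot hvX huX hs)

/-- The augmented relation generates H-walks avoiding `X`. -/
theorem IsHubSet.hConnAvoid_of_rtg_aug {X : Set V} (hXc : c ∉ X) {x y : V}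
    (h : Relation.ReflTransGen (G.AugAdj Hs X ω a b c) x y) : G.HConnAvoid ω c X x y := by
  induction h with
  | refl => exact Relation.ReflTransGen.refl
  | tail _ hstep ih => exact ih.trans (hH.hConnAvoid_of_augAdj hbot hXc hstep)

end Walk

end MultiGraph

end PercRepro
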